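import Summits.BirchSwinnertonDyer.BirchSwinnertonDyer.Theorems.AlignedTransportAtTwoMainConjectureOfRankZeroBSDAtTwoOrdinaryStandardShapeCMSextic
import Summits.BirchSwinnertonDyer.BirchSwinnertonDyer.Theorems.AlignedTransportAtTwoMainConjectureOfRankZeroBSDAtTwoOrdinaryStandardShapeRefined
import HarnessLib

/-!
# Route `AlignedTransportAtTwo`, crux C2 `MainConjectureOfRankZeroBSDAtTwo` (stmt-BirchSwinnertonDyer-22298):
# THE DYADIC STRATA IN TRIPLE CURRENCY — on a refined shape triple (`4 ∣ a₄`, `a₆` odd) one has `Δ[1,a₂,0,a₄,a₆] ≡ −(1+4a₂)·a₆ (mod 8)`,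
# so the three `2`-adic strata of the cell (split / Kilford `Δ_min ≡ 1 (8)`, unramified-quadratic `Δ_min ≡ 5 (8)`, ramified `Δ_min ≡ 3 (4)`)
# are the congruence classes `a₆ + 4a₂ ≡ 7 (8)`, `a₆ + 4a₂ ≡ 3 (8)`, `a₆ ≡ 1 (4)`; the one-clause named input SHAPE_CM splits accordingly

HONEST FRAMING. WIDTH-5 attached prover seat `bsd-line-att-p4` g36 on line `birth` of the lead `bsd-line-att-p2` (WAKE-only); `--supports`
stmt-BirchSwinnertonDyer-22298, closes nothing; BSD is NOT proved; crux C2, its verdict «blocked-on `Rank1Residual.GreenbergMuConjectureIrreducible`»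
and every registered stub (P / T / Kμ / LimDoor / MuIneqʳ / PFμ⁺ of `Lines/birth.lean` v9) untouched. THEOREMS ONLY (no `def`, no named fact, no `sorry`);
everything here is UNCONDITIONAL arithmetic / logic about the restatements — nothing is asserted about any `μ`-invariant. Sequel of
`…OrdinaryStandardShapeRefined` (att-p4 g35: every globally minimal good-ordinary-at-`2` curve has a REFINED shape `4 ∣ a₄`, `a₆` odd with
`Δ[1,a₂,0,a₄,a₆] = Δ_min(W)`), `…OrdinaryStandardShapeCMSextic` (this seat: SHAPE_CM ⟺ LOCAL_CM) and att-p4 g11's decidable Kilford dictionary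
`onKilfordStratumAtTwo_iff_minimalDiscriminantInt_emod_eight` (`c_W` splits over `ℚ₂` ⟺ `Δ_min ≡ 1 (mod 8)`).

WHY. The cell's door table is indexed by the `2`-adic stratum of the cubic `2`-torsion field `F = ℚ(β)` (`F ⊗ ℚ₂ ≅ ℚ₂ × ℚ₂(√Δ_min)`): SPLIT / Kilford
(`Δ_min ≡ 1 (8)`, three primes above `2`: att-p3's rank-jump doors), UNRAMIFIED (`Δ_min ≡ 5 (8)`, `2 = 𝔭₁𝔭₂`, `f = 1, 2`: Chevalley / unit-index / layer-one
unit doors, the ODDBRANCH census), RAMIFIED (`Δ_min ≡ 3 (4)`, `2 = 𝔭₁𝔭₂²`: the layer-`≥ 1` rank door). In the integer-triple currency of the named input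
these strata are CONGRUENCE CLASSES of `(a₂ mod 2, a₆ mod 8)` once the shape is refined:

* §1 ★★ `Δ_standard_eq_of_four_dvd` / `Δ_standard_emod_eight_of_four_dvd` — **`4 ∣ a₄ ⟹ Δ[1,a₂,0,a₄,a₆] = −(1+4a₂)a₆ + 8k`**, explicitly; with `a₆` odd:
  ★★ `Δ_emod_four_eq_three_iff` (`Δ ≡ 3 (4) ⟺ a₆ ≡ 1 (4)`), ★★ `Δ_emod_eight_eq_one_iff` (`Δ ≡ 1 (8) ⟺ a₆ + 4a₂ ≡ 7 (8)`), ★★ `Δ_emod_eight_eq_five_iff`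
  (`Δ ≡ 5 (8) ⟺ a₆ + 4a₂ ≡ 3 (8)`), `strata_trichotomy` (exactly one of the three classes).
* §2 curve side: for `W` globally minimal, good ordinary at `2`, and ANY refined shape `(a₂, a₄, a₆)` of `W` (`4 ∣ a₄`, `a₆` odd, `Δ[1,a₂,0,a₄,a₆] = Δ_min(W)`):
  ★★ `onKilfordStratumAtTwo_iff_of_refinedShape` (**ON the Kilford stratum ⟺ `a₆ + 4a₂ ≡ 7 (mod 8)`**), `minimalDiscriminantInt_emod_eight_eq_five_iff_of_refinedShape`,
  `minimalDiscriminantInt_emod_four_eq_three_iff_of_refinedShape`.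
* §3 triple side: `refinedShapeCM_iff_shapeCM` (SHAPE_CM may be restricted to refined triples — the CM twin of g35's `narrowMu_refinedShape_iff_standardShape`),
  ★★★ `shapeCM_iff_strata` — **SHAPE_CM ⟺ SHAPE_CM[ram: `a₆ ≡ 1 (4)`] ∧ SHAPE_CM[unr: `a₆ + 4a₂ ≡ 3 (8)`] ∧ SHAPE_CM[split: `a₆ + 4a₂ ≡ 7 (8)`]** (refined
  triples): three sub-conjectures indexed by explicit congruence classes, one per door family.
RESTATEMENT MENU (D-0014): the planner may file the three strata conjectures separately (each OPEN IN PRINT; the split class is the locus of Kilford's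
mod-`2` multiplicity-one failures for C1, the unramified class carries the ODDBRANCH census of att-p5 g31 / att-p3 g41). Expected REF2 grade
COROLLARY-OF-TREE (Silverman III.§1 + Serre, Cours d'arithmétique II.3.3). PARTITION: none; beyond-print theorem: no; BSD is NOT proved by any of this.

References: [SilvermanAEC2009] III.§1, VII.§2; [Serre1973] Ch. II §3.3 Thm 4; [NeukirchANT1999] II.§8; tree: `…OrdinaryStandardShape{,Refined,CMSextic}`
(att-p4 g35/g36), `…KilfordStratumShared` (att-p4 g11), `TwoAdicConverseTwoDivisionCubicDyadicType` (bsd-2adic conv-1).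
-/

-- the Theorems namespace of this sub repeats the summit name by design (D-0017 nested layout)
set_option linter.dupNamespace false
set_option autoImplicit false

noncomputable section

open scoped NumberField IntermediateField

namespace Summit.BirchSwinnertonDyer.BirchSwinnertonDyer.Theorems.AlignedTransportAtTwoOrdinaryStandardShapeStrata

open NumberField Polynomial WeierstrassCurve IntermediateField Field CongruenceSubgroup
  Literature.NumberTheory.EllipticCurves Literature.NumberTheory.EllipticCurves.Greenberg1999
  Literature.NumberTheory.EllipticCurves.ModularForms Literature.NumberTheory.EllipticCurves.Rank1Residual
  Literature.NumberTheory.EllipticCurves.Module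
  Literature.NumberTheory.EllipticCurves.DokchitserDokchitser2012
  Literature.NumberTheory.EllipticCurves.ZpExtension Literature.NumberTheory.GaloisRepresentations
  Literature.NumberTheory.IwasawaTheory Literature.NumberTheory.NumberFields
  Summit.BirchSwinnertonDyer.Rank1Residual Summit.BirchSwinnertonDyer.Rank1Residual.X1.MuLambda
  Summit.BirchSwinnertonDyer.Rank1Residual.X5 Summit.BirchSwinnertonDyer.Rank1Residual.F1Sign2
  Summit.BirchSwinnertonDyer.BirchSwinnertonDyer.Theorems.Rank1ResidualX1Defs
  Summit.BirchSwinnertonDyer.BirchSwinnertonDyer.Theses.AlignedTransportAtTwo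
  Summit.BirchSwinnertonDyer.BirchSwinnertonDyer.Theorems.AlignedTransportAtTwoOrdinaryStandardShape
  Summit.BirchSwinnertonDyer.BirchSwinnertonDyer.Theorems.AlignedTransportAtTwoOrdinaryStandardShapeExact
  Summit.BirchSwinnertonDyer.BirchSwinnertonDyer.Theorems.AlignedTransportAtTwoOrdinaryStandardShapeCrux
  Summit.BirchSwinnertonDyer.BirchSwinnertonDyer.Theorems.AlignedTransportAtTwoOrdinaryStandardShapeRefined
  Summit.BirchSwinnertonDyer.BirchSwinnertonDyer.Theorems.AlignedTransportAtTwoOrdinaryStandardShapeCMSextic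
  Summit.BirchSwinnertonDyer.BirchSwinnertonDyer.Theorems.AlignedTransportAtTwoKilfordStratumShared

/-! ## §1 `Δ[1,a₂,0,a₄,a₆] (mod 8)` on a refined shape -/

section Congruence

variable (a₂ a₄ a₆ : ℤ)

/-- ★★ **`4 ∣ a₄ ⟹ Δ[1, a₂, 0, a₄, a₆] = −(1 + 4a₂)·a₆ + 8k`**, with the explicit `k` (`a₄ = 4c`; all other terms of Silverman's `Δ` are divisible by `8`).
[cite: SilvermanAEC2009, III.§1] -/
theorem Δ_standard_eq_of_four_dvd {c : ℤ} (hc : a₄ = 4 * c) :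
    (⟨1, a₂, 0, a₄, a₆⟩ : WeierstrassCurve ℤ).Δ =
      -((1 + 4 * a₂) * a₆) + 8 * (2 * (1 + 4 * a₂) ^ 2 * c ^ 2 - 512 * c ^ 3 - 54 * a₆ ^ 2 + 36 * (1 + 4 * a₂) * c * a₆
        - a₆ * (a₂ + 6 * a₂ ^ 2 + 8 * a₂ ^ 3)) := by
  rw [Δ_standard_eq, hc]
  ring

/-- ★★ **`4 ∣ a₄ ⟹ Δ[1, a₂, 0, a₄, a₆] ≡ −(1 + 4a₂)·a₆ (mod 8).`** [cite: SilvermanAEC2009, III.§1] -/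
theorem Δ_standard_emod_eight_of_four_dvd (h4 : 4 ∣ a₄) :
    (⟨1, a₂, 0, a₄, a₆⟩ : WeierstrassCurve ℤ).Δ ≡ -((1 + 4 * a₂) * a₆) [ZMOD 8] := by
  obtain ⟨c, hc⟩ := h4
  rw [Δ_standard_eq_of_four_dvd a₂ a₄ a₆ hc, Int.ModEq]
  omega

variable {a₂ a₄ a₆}

/-- On a refined shape (`4 ∣ a₄`, `a₆` odd): `(1 + 4a₂)·a₆ ≡ a₆ + 4a₂ (mod 8)` and `Δ ≡ −(a₆ + 4a₂) (mod 8)` — a linear reading (`a₂a₆ ≡ a₂ (mod 2)`).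
[cite: SilvermanAEC2009, III.§1] -/
theorem Δ_add_emod_eight_of_refined (h4 : 4 ∣ a₄) (h6 : Odd a₆) :
    ((⟨1, a₂, 0, a₄, a₆⟩ : WeierstrassCurve ℤ).Δ + (a₆ + 4 * a₂)) % 8 = 0 := by
  obtain ⟨c, hc⟩ := h4
  obtain ⟨t, ht⟩ := h6
  have hΔ := Δ_standard_eq_of_four_dvd a₂ a₄ a₆ hc
  have hm : (1 + 4 * a₂) * a₆ = a₆ + 4 * a₂ + 8 * (a₂ * t) := by rw [ht]; ring
  rw [hm] at hΔ
  omega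

/-- ★★ **RAMIFIED stratum: `Δ[1,a₂,0,a₄,a₆] ≡ 3 (mod 4) ⟺ a₆ ≡ 1 (mod 4)`** (refined shape; `2` ramifies in the root field, `2 = 𝔭₁𝔭₂²`).
[cite: SilvermanAEC2009, III.§1] [cite: NeukirchANT1999, Ch. II §8 (8.1)–(8.3)] -/
theorem Δ_emod_four_eq_three_iff (h4 : 4 ∣ a₄) (h6 : Odd a₆) :
    (⟨1, a₂, 0, a₄, a₆⟩ : WeierstrassCurve ℤ).Δ % 4 = 3 ↔ a₆ % 4 = 1 := by
  have h := Δ_add_emod_eight_of_refined (a₂ := a₂) h4 h6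
  obtain ⟨t, ht⟩ := h6
  omega

/-- ★★ **SPLIT (Kilford) stratum: `Δ[1,a₂,0,a₄,a₆] ≡ 1 (mod 8) ⟺ a₆ + 4a₂ ≡ 7 (mod 8)`** (refined shape; `Δ ∈ ℚ₂ײ`, three primes above `2`).
[cite: SilvermanAEC2009, III.§1] [cite: Serre1973, Ch. II §3.3 Thm 4] -/
theorem Δ_emod_eight_eq_one_iff (h4 : 4 ∣ a₄) (h6 : Odd a₆) :
    (⟨1, a₂, 0, a₄, a₆⟩ : WeierstrassCurve ℤ).Δ % 8 = 1 ↔ (a₆ + 4 * a₂) % 8 = 7 := by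
  have h := Δ_add_emod_eight_of_refined (a₂ := a₂) h4 h6
  omega

/-- ★★ **UNRAMIFIED stratum: `Δ[1,a₂,0,a₄,a₆] ≡ 5 (mod 8) ⟺ a₆ + 4a₂ ≡ 3 (mod 8)`** (refined shape; `2 = 𝔭₁𝔭₂` with `f = 1, 2`: the ODDBRANCH habitat).
[cite: SilvermanAEC2009, III.§1] [cite: Serre1973, Ch. II §3.3 Thm 4] -/
theorem Δ_emod_eight_eq_five_iff (h4 : 4 ∣ a₄) (h6 : Odd a₆) :
    (⟨1, a₂, 0, a₄, a₆⟩ : WeierstrassCurve ℤ).Δ % 8 = 5 ↔ (a₆ + 4 * a₂) % 8 = 3 := by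
  have h := Δ_add_emod_eight_of_refined (a₂ := a₂) h4 h6
  omega

/-- **Trichotomy**: a refined triple lies in exactly one stratum class — `a₆ ≡ 1 (mod 4)`, or `a₆ + 4a₂ ≡ 3 (mod 8)`, or `a₆ + 4a₂ ≡ 7 (mod 8)` (the last two
have `a₆ ≡ 3 (mod 4)`). [folklore] -/
theorem strata_trichotomy (h6 : Odd a₆) :
    (a₆ % 4 = 1 ∨ (a₆ + 4 * a₂) % 8 = 3 ∨ (a₆ + 4 * a₂) % 8 = 7) ∧
      ¬ (a₆ % 4 = 1 ∧ (a₆ + 4 * a₂) % 8 = 3) ∧ ¬ (a₆ % 4 = 1 ∧ (a₆ + 4 * a₂) % 8 = 7) ∧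
      ¬ ((a₆ + 4 * a₂) % 8 = 3 ∧ (a₆ + 4 * a₂) % 8 = 7) := by
  obtain ⟨t, ht⟩ := h6
  omega

end Congruence

/-! ## §2 The strata of a cell curve read on any of its refined shapes -/

section Curve

variable (W : WeierstrassCurve ℚ) [W.IsElliptic] [W.IsGloballyMinimal]

/-- ★★ **ON the Kilford stratum ⟺ `a₆ + 4a₂ ≡ 7 (mod 8)`**, for `W` globally minimal, good ordinary at `2`, and ANY refined shape `(a₂, a₄, a₆)` of `W`
(`4 ∣ a₄`, `a₆` odd, `Δ[1,a₂,0,a₄,a₆] = Δ_min(W)` — e.g. the one of g35's `exists_refinedShape_of_isOrdinaryAt`): att-p4 g11's `Δ_min ≡ 1 (mod 8)` dictionary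
read on the triple. [cite: Serre1973, Ch. II §3.3 Thm 4] [cite: SilvermanAEC2009, III.§1 and VII.§2] -/
theorem onKilfordStratumAtTwo_iff_of_refinedShape (hord : IsOrdinaryAt W 2) {a₂ a₄ a₆ : ℤ} (h4 : 4 ∣ a₄) (h6 : Odd a₆)
    (hΔ : (⟨1, a₂, 0, a₄, a₆⟩ : WeierstrassCurve ℤ).Δ = minimalDiscriminantInt W) :
    OnKilfordStratumAtTwo W ↔ (a₆ + 4 * a₂) % 8 = 7 := by
  rw [onKilfordStratumAtTwo_iff_minimalDiscriminantInt_emod_eight W hord, ← hΔ]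
  exact Δ_emod_eight_eq_one_iff h4 h6

omit [W.IsElliptic] in
/-- **`Δ_min(W) ≡ 5 (mod 8) ⟺ a₆ + 4a₂ ≡ 3 (mod 8)`** on any refined shape of `W` (the unramified stratum: `2 = 𝔭₁𝔭₂`, `f = 1, 2`).
[cite: SilvermanAEC2009, III.§1] [cite: NeukirchANT1999, Ch. II §8 (8.1)–(8.3)] -/
theorem minimalDiscriminantInt_emod_eight_eq_five_iff_of_refinedShape {a₂ a₄ a₆ : ℤ} (h4 : 4 ∣ a₄) (h6 : Odd a₆)
    (hΔ : (⟨1, a₂, 0, a₄, a₆⟩ : WeierstrassCurve ℤ).Δ = minimalDiscriminantInt W) :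
    minimalDiscriminantInt W % 8 = 5 ↔ (a₆ + 4 * a₂) % 8 = 3 := by
  rw [← hΔ]
  exact Δ_emod_eight_eq_five_iff h4 h6

omit [W.IsElliptic] in
/-- **`Δ_min(W) ≡ 3 (mod 4) ⟺ a₆ ≡ 1 (mod 4)`** on any refined shape of `W` (the ramified stratum: `2 = 𝔭₁𝔭₂²`).
[cite: SilvermanAEC2009, III.§1] [cite: NeukirchANT1999, Ch. II §8 (8.1)–(8.3)] -/
theorem minimalDiscriminantInt_emod_four_eq_three_iff_of_refinedShape {a₂ a₄ a₆ : ℤ} (h4 : 4 ∣ a₄) (h6 : Odd a₆)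
    (hΔ : (⟨1, a₂, 0, a₄, a₆⟩ : WeierstrassCurve ℤ).Δ = minimalDiscriminantInt W) :
    minimalDiscriminantInt W % 4 = 3 ↔ a₆ % 4 = 1 := by
  rw [← hΔ]
  exact Δ_emod_four_eq_three_iff h4 h6

/-- **Every cell-local curve has a refined shape in exactly one stratum class, and the class is that of `Δ_min(W)`**: packaging of g35's refined normal
form with §1 (the ON/OFF-Kilford reading included). [cite: SilvermanAEC2009, III.§1 Table 3.1 and VII.§2] [cite: Serre1973, Ch. II §3.3 Thm 4] -/
theorem exists_refinedShape_with_stratum (hord : IsOrdinaryAt W 2) :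
    ∃ a₂ a₄ a₆ r : ℤ, 4 ∣ a₄ ∧ Odd a₆ ∧ (⟨1, a₂, 0, a₄, a₆⟩ : WeierstrassCurve ℤ).Δ = minimalDiscriminantInt W ∧
      (∀ {K : Type} [Field K] [CharZero K] [Algebra ℚ K] (e : K),
        aeval e (twoDivisionUCubic W) = 0 ↔
          (e - 4 * (r : K)) ^ 3 + (1 + 4 * (a₂ : K)) * (e - 4 * (r : K)) ^ 2 + 16 * (a₄ : K) * (e - 4 * (r : K)) + 64 * (a₆ : K) = 0) ∧
      (OnKilfordStratumAtTwo W ↔ (a₆ + 4 * a₂) % 8 = 7) ∧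
      (minimalDiscriminantInt W % 8 = 5 ↔ (a₆ + 4 * a₂) % 8 = 3) ∧
      (minimalDiscriminantInt W % 4 = 3 ↔ a₆ % 4 = 1) := by
  obtain ⟨a₂, a₄, a₆, r, h4, h6, hΔ, hroot⟩ := exists_refinedShape_of_isOrdinaryAt W hord
  exact ⟨a₂, a₄, a₆, r, h4, h6, hΔ, hroot, onKilfordStratumAtTwo_iff_of_refinedShape W hord h4 h6 hΔ,
    minimalDiscriminantInt_emod_eight_eq_five_iff_of_refinedShape W h4 h6 hΔ,
    minimalDiscriminantInt_emod_four_eq_three_iff_of_refinedShape W h4 h6 hΔ⟩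

end Curve

/-! ## §3 SHAPE_CM on refined triples and its split into the three strata -/

section Shape

/-- **SHAPE_CM may be restricted to refined triples** (`4 ∣ a₄`, `a₆` odd): the CM twin of g35's `narrowMu_refinedShape_iff_standardShape` (refined ⟹ LOCAL_CM
by the refined normal form; LOCAL_CM ⟹ SHAPE_CM by the exact image, `…CMSextic.shapeCM_of_localCM`; SHAPE_CM ⟹ refined since `4 ∣ a₄`, `a₆` odd ⟹ `a₄ + a₆` odd).
UNCONDITIONAL; both sides OPEN; nothing asserted about them. [cite: SilvermanAEC2009, III.§1 Table 3.1 and VIII.§8 Cor. 8.3] [cite: Greenberg2001IwasawaPastPresent, §4] -/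
theorem refinedShapeCM_iff_shapeCM :
    (∀ a₂ a₄ a₆ : ℤ, 4 ∣ a₄ → Odd a₆ →
      (∀ x : ℚ, x ^ 3 + (1 + 4 * (a₂ : ℚ)) * x ^ 2 + 16 * (a₄ : ℚ) * x + 64 * (a₆ : ℚ) ≠ 0) →
      ¬ IsSquare (⟨1, a₂, 0, a₄, a₆⟩ : WeierstrassCurve ℤ).Δ →
      ∀ (F' : Type) [Field F'] [NumberField F'], Module.finrank ℚ F' = 6 →
      ∀ e i : F', e ^ 3 + (1 + 4 * (a₂ : F')) * e ^ 2 + 16 * (a₄ : F') * e + 64 * (a₆ : F') = 0 → i ^ 2 = -1 →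
      ∀ κ : ZpExtension F' 2, κ.IsCyclotomic → ClassicalMuVanishes κ) ↔
    (∀ a₂ a₄ a₆ : ℤ, Odd (a₄ + a₆) →
      (∀ x : ℚ, x ^ 3 + (1 + 4 * (a₂ : ℚ)) * x ^ 2 + 16 * (a₄ : ℚ) * x + 64 * (a₆ : ℚ) ≠ 0) →
      ¬ IsSquare (⟨1, a₂, 0, a₄, a₆⟩ : WeierstrassCurve ℤ).Δ →
      ∀ (F' : Type) [Field F'] [NumberField F'], Module.finrank ℚ F' = 6 →
      ∀ e i : F', e ^ 3 + (1 + 4 * (a₂ : F')) * e ^ 2 + 16 * (a₄ : F') * e + 64 * (a₆ : F') = 0 → i ^ 2 = -1 →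
      ∀ κ : ZpExtension F' 2, κ.IsCyclotomic → ClassicalMuVanishes κ) := by
  constructor
  · intro hR
    refine shapeCM_of_localCM fun W _ _ hord ht hsq F' _ _ hF' e i he hi ↦ ?_
    obtain ⟨a₂, a₄, a₆, r, h4, h6, hΔ, hroot⟩ := exists_refinedShape_of_isOrdinaryAt W hord
    have hnsq : ¬ IsSquare (⟨1, a₂, 0, a₄, a₆⟩ : WeierstrassCurve ℤ).Δ := by
      rw [hΔ]
      rintro ⟨s, hs⟩
      exact hsq ⟨s, by rw [← cast_minimalDiscriminantInt W, hs]; push_cast; ring⟩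
    exact hR a₂ a₄ a₆ h4 h6 (shape_ne_zero_of_forall_not_hasRationalTwoTorsionX W ht hroot) hnsq F' hF' (e - 4 * (r : F')) i
      ((hroot e).mp he) hi
  · intro hS a₂ a₄ a₆ h4 h6 hirr hnsq F' _ _ hF' e i he hi
    have hodd : Odd (a₄ + a₆) := by
      obtain ⟨c, hc⟩ := h4
      obtain ⟨t, ht⟩ := h6
      exact ⟨2 * c + t, by rw [hc, ht]; ring⟩
    exact hS a₂ a₄ a₆ hodd hirr hnsq F' hF' e i he hi

/-- ★★★ **SHAPE_CM ⟺ SHAPE_CM[ramified] ∧ SHAPE_CM[unramified] ∧ SHAPE_CM[split]** — the one-clause named input of C2 splits over the three DYADIC STRATA,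
each an explicit congruence class of refined triples: ramified `a₆ ≡ 1 (mod 4)` (`Δ ≡ 3 (4)`, `2 = 𝔭₁𝔭₂²` in the cubic root field), unramified
`a₆ + 4a₂ ≡ 3 (mod 8)` (`Δ ≡ 5 (8)`, `2 = 𝔭₁𝔭₂`, `f = 1, 2` — the ODDBRANCH habitat), split `a₆ + 4a₂ ≡ 7 (mod 8)` (`Δ ≡ 1 (8)`, Kilford stratum, three primes).
One sub-conjecture per door family of the cell; all three OPEN IN PRINT; nothing asserted about them. UNCONDITIONAL.
[cite: SilvermanAEC2009, III.§1] [cite: Serre1973, Ch. II §3.3 Thm 4] [cite: Greenberg2001IwasawaPastPresent, §4 (Iwasawa's μ = 0 conjecture)] -/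
theorem shapeCM_iff_strata :
    (∀ a₂ a₄ a₆ : ℤ, Odd (a₄ + a₆) →
      (∀ x : ℚ, x ^ 3 + (1 + 4 * (a₂ : ℚ)) * x ^ 2 + 16 * (a₄ : ℚ) * x + 64 * (a₆ : ℚ) ≠ 0) →
      ¬ IsSquare (⟨1, a₂, 0, a₄, a₆⟩ : WeierstrassCurve ℤ).Δ →
      ∀ (F' : Type) [Field F'] [NumberField F'], Module.finrank ℚ F' = 6 →
      ∀ e i : F', e ^ 3 + (1 + 4 * (a₂ : F')) * e ^ 2 + 16 * (a₄ : F') * e + 64 * (a₆ : F') = 0 → i ^ 2 = -1 →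
      ∀ κ : ZpExtension F' 2, κ.IsCyclotomic → ClassicalMuVanishes κ) ↔
    ((∀ a₂ a₄ a₆ : ℤ, 4 ∣ a₄ → Odd a₆ → a₆ % 4 = 1 →
        (∀ x : ℚ, x ^ 3 + (1 + 4 * (a₂ : ℚ)) * x ^ 2 + 16 * (a₄ : ℚ) * x + 64 * (a₆ : ℚ) ≠ 0) →
        ¬ IsSquare (⟨1, a₂, 0, a₄, a₆⟩ : WeierstrassCurve ℤ).Δ →
        ∀ (F' : Type) [Field F'] [NumberField F'], Module.finrank ℚ F' = 6 →
        ∀ e i : F', e ^ 3 + (1 + 4 * (a₂ : F')) * e ^ 2 + 16 * (a₄ : F') * e + 64 * (a₆ : F') = 0 → i ^ 2 = -1 →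
        ∀ κ : ZpExtension F' 2, κ.IsCyclotomic → ClassicalMuVanishes κ) ∧
      (∀ a₂ a₄ a₆ : ℤ, 4 ∣ a₄ → Odd a₆ → (a₆ + 4 * a₂) % 8 = 3 →
        (∀ x : ℚ, x ^ 3 + (1 + 4 * (a₂ : ℚ)) * x ^ 2 + 16 * (a₄ : ℚ) * x + 64 * (a₆ : ℚ) ≠ 0) →
        ¬ IsSquare (⟨1, a₂, 0, a₄, a₆⟩ : WeierstrassCurve ℤ).Δ →
        ∀ (F' : Type) [Field F'] [NumberField F'], Module.finrank ℚ F' = 6 →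
        ∀ e i : F', e ^ 3 + (1 + 4 * (a₂ : F')) * e ^ 2 + 16 * (a₄ : F') * e + 64 * (a₆ : F') = 0 → i ^ 2 = -1 →
        ∀ κ : ZpExtension F' 2, κ.IsCyclotomic → ClassicalMuVanishes κ) ∧
      (∀ a₂ a₄ a₆ : ℤ, 4 ∣ a₄ → Odd a₆ → (a₆ + 4 * a₂) % 8 = 7 →
        (∀ x : ℚ, x ^ 3 + (1 + 4 * (a₂ : ℚ)) * x ^ 2 + 16 * (a₄ : ℚ) * x + 64 * (a₆ : ℚ) ≠ 0) →
        ¬ IsSquare (⟨1, a₂, 0, a₄, a₆⟩ : WeierstrassCurve ℤ).Δ →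
        ∀ (F' : Type) [Field F'] [NumberField F'], Module.finrank ℚ F' = 6 →
        ∀ e i : F', e ^ 3 + (1 + 4 * (a₂ : F')) * e ^ 2 + 16 * (a₄ : F') * e + 64 * (a₆ : F') = 0 → i ^ 2 = -1 →
        ∀ κ : ZpExtension F' 2, κ.IsCyclotomic → ClassicalMuVanishes κ)) := by
  rw [← refinedShapeCM_iff_shapeCM]
  constructor
  · intro hR
    exact ⟨fun a₂ a₄ a₆ h4 h6 _ ↦ hR a₂ a₄ a₆ h4 h6, fun a₂ a₄ a₆ h4 h6 _ ↦ hR a₂ a₄ a₆ h4 h6,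
      fun a₂ a₄ a₆ h4 h6 _ ↦ hR a₂ a₄ a₆ h4 h6⟩
  · rintro ⟨hram, hunr, hsplit⟩ a₂ a₄ a₆ h4 h6
    rcases (strata_trichotomy (a₂ := a₂) h6).1 with h | h | h
    · exact hram a₂ a₄ a₆ h4 h6 h
    · exact hunr a₂ a₄ a₆ h4 h6 h
    · exact hsplit a₂ a₄ a₆ h4 h6 h

end Shape

end Summit.BirchSwinnertonDyer.BirchSwinnertonDyer.Theorems.AlignedTransportAtTwoOrdinaryStandardShapeStrata

end
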